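import Summits.HubbardSuperconductivity.HubbardSuperconductivity.Theorems.AnisotropyChordTransferFibre3TargetsV3
import Summits.HubbardSuperconductivity.HubbardSuperconductivity.Theorems.AnisotropyChordTransferFibre3Invertible

/-!
# Route `AnisotropyChord` / H0 rotor rung: PORT N31 — β-FREE ∀L TARGETS OF THE GM₃ CERTIFICATE, THE PARAMETRISED ASSEMBLY, THE ONE-LOOP IDENTITY LAYER

Verbatim port (modulo this header, the port comment and lint options) of the theory seat's statement file
`hubbard-h0-rotor-theory-1/cycle21/lean/PartN31.lean` (sha16 `59dfbfbb7b65c2a3`, 2026-08-29T15:32Z; memo ROTOR-THEORY-21 §296–§302).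
Statements only (targets typed by the theory seat; no proofs claimed here): `IsGroundTwoMagnon` (two-magnon profile + evenness +
minimality), the β-free units `etaEff`, `Uunit`, `mHole`, `g0hat`, `facMI`, `trialGapN1`, `resid`, `polePart`, `lowSet`, `lowNormPart`,
`lowGForm`; the β-free cruxes `TrialGapAbs` (KT-1″), `LowShellGFormAbs` (KT-2a″), `OffPoleTailAbs` (KT-2b″); the structural lemmas
`DenMinRest`, `L2Quant`; the PARAMETRISED assembly `KTAssemblyAbs Δ c a b ρ`; and the identity layer `GreenZeroIdentity`,
`PolePairingIdentity`, `VResidualPairing`, `PiHatOneLoop`, `FsqFourier`.  Proofs of the implication `KTAssemblyAbs` and of the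
identities are the prover's and live in separate files.  Prover seat `hubbard-h0-rotor-p1` g22; helper for
stmt-HubbardSuperconductivity-19089 (`--supports`).

Theory seat's own summary of the file:
# PartN31 — β-FREE ∀L TARGETS OF THE GM₃ CERTIFICATE, THE PARAMETRISED ASSEMBLY, AND THE ONE-LOOP IDENTITY LAYER
(theory seat `hubbard-h0-rotor-theory-1`, g21, memo ROTOR-THEORY-21 §296–§302; statements only — proofs are the prover's.)

What is new relative to `…TargetsV2/V3`:
* `IsGroundTwoMagnon` = `IsTwoMagnon` + evenness + MINIMALITY of `lam2` (the cruxes are meant at the ground eigenvalue, where `f`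
  is unique; minimality gives `lam2 ≤ 4(1−Δ)/(V−1) < ε₁`, all the smallness the one-loop layer uses). `lam2` is bound INSIDE the new Props.
* β-free currency (memo 21 §296: `β = ⟨v,Ψ¹⟩/3V² > 0` multiplies both sides of the master inequality and cancels):
  `TrialGapAbs Δ c` (KT-1″: `N₁ ≥ c·U`, `U = 3V²T⁺`), `LowShellGFormAbs Δ a` (KT-2a″), `OffPoleTailAbs Δ b` (KT-2b″: the residual norm with its EXACT pole part
  and low-shell part subtracted — both are one-loop numbers), `DenMinRest ρ`, `L2Quant` (LEMMA κ₀ in p1's `Qtilde` language), and the PARAMETRISED assembly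
  `KTAssemblyAbs Δ c a b ρ` whose arithmetic side condition is an explicit hypothesis (so constants can move without re-typing).
* the identity layer of memo 21 §297 as `Prop`s: `GreenZeroIdentity`, `PolePairingIdentity`, `VResidualPairing`, `PiHatOneLoop`, `FsqFourier`.
Measured (brute force, L ≤ 32, all Δ): `N₁/U ∈ [.53,.65]`, rigorous Level-1 lower bound `≥ .30` (`≥ .45` for Δ ≥ .5); `a″ ≤ .038`; `b″_eff ≤ .46` (CS) / `≤ .12` (true);
`ρ ≥ 2.95`; `fac·η_eff ≤ 1.3`; side condition holds with margin ≥ .19 for `(a,b,ρ) = (.06,.55,2.95)` and `c =` the Level-1 bound.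
-/

-- Port of theory seat `hubbard-h0-rotor-theory-1` cycle21/lean/PartN31.lean (sha16 59dfbfbb7b65c2a3) verbatim modulo this header,
-- `set_option linter.dupNamespace false` and lint fixes; prover seat `hubbard-h0-rotor-p1` g22, `--supports stmt-HubbardSuperconductivity-19089`.


set_option linter.dupNamespace false

open scoped BigOperators
open Complex

namespace Summit.HubbardSuperconductivity.HubbardSuperconductivity.Theorems.AnisotropyChord.Transfer.Fibre3

variable (L : ℕ) [NeZero L]

/-! ## The ground two-magnon profile and the β-free units -/

/-- the `K = 0` two-magnon quadratic form `Σ_r g(r)[Σ_e (g(r) − g(r+e)) − Δ·1_{NN}(r) g(r)]` (relative coordinate; hopping ½ per magnon). -/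
noncomputable def twoMagnonQF (Δ : ℝ) (g : Tor L → ℝ) : ℝ :=
  ∑ r : Tor L, g r * (((nnList L).map (fun e => g r - g (r + e))).sum - Δ * (if IsNN L r then 1 else 0) * g r)

/-- `f` is THE ground-state profile: two-magnon eigenfunction (`IsTwoMagnon`), even, and `lam2` is the minimum of the
form over functions vanishing at the origin (⇒ `lam2 ≤ 4(1−Δ)/(V−1)`, `f > 0`, uniqueness). -/
def IsGroundTwoMagnon (Δ lam2 : ℝ) (f : Tor L → ℝ) : Prop :=
  IsTwoMagnon L Δ lam2 f ∧ (∀ r : Tor L, f (-r) = f r) ∧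
    ∀ g : Tor L → ℝ, g 0 = 0 → lam2 * (∑ r : Tor L, g r ^ 2) ≤ twoMagnonQF L Δ g

/-- `η_eff := V λ₂ / 4` (`= (1−Δ) f(x̂)` by the sum rule). -/
noncomputable def etaEff (lam2 : ℝ) : ℝ := (L : ℝ) ^ 2 * lam2 / 4

/-- the unit `U := 3V² T⁺`. -/
noncomputable def Uunit (Δ : ℝ) (f : Tor L → ℝ) : ℝ := 3 * ((L : ℝ) ^ 2) ^ 2 * Tplus L Δ f

/-- `m := ½ε₁(1 − 5/V + 6/V²) − T⁺`, the punctured-torus gap margin of THEOREM G2 at `E = ε₁ + T⁺`. -/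
noncomputable def mHole (Δ : ℝ) (f : Tor L → ℝ) : ℝ :=
  eps1 L * (1 - 5 / (L : ℝ) ^ 2 + 6 / ((L : ℝ) ^ 2) ^ 2) / 2 - Tplus L Δ f

/-- `ĝ₀ := (3(1−Δ) + m)/(3 + m)` — the L2 shell constant (LEMMA κ₀). -/
noncomputable def g0hat (Δ : ℝ) (f : Tor L → ℝ) : ℝ := (3 * (1 - Δ) + mHole L Δ f) / (3 + mHole L Δ f)

/-- the master-inequality factor `fac := 1 + κ_E Δ / ĝ₀`. -/
noncomputable def facMI (Δ : ℝ) (f : Tor L → ℝ) : ℝ := 1 + kappaE L Δ f * Δ / g0hat L Δ f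

/-- `N₁ := Re⟨Ψ¹, (H − ε₁ − T⁺) Ψ¹⟩`, the trial gap numerator. -/
noncomputable def trialGapN1 (Δ : ℝ) (f : Tor L → ℝ) : ℝ :=
  (ip L (trialK1 L f) (Happly L (K1 L) Δ (trialK1 L f))).re - (eps1 L + Tplus L Δ f) * (ip L (trialK1 L f) (trialK1 L f)).re

/-- `R′ := 1_{Dᶜ}(H − ε₁ − T⁺)Ψ¹`. -/
noncomputable def resid (Δ : ℝ) (f : Tor L → ℝ) : Cfg L → ℂ := residual L (Tplus L Δ f) Δ (trialK1 L f)

/-- the pole part `P := Σ_j |⟨p_j, R′⟩|² / V²` (`‖p_j‖² = V²`; invisible to the pole-removed resolvent). -/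
noncomputable def polePart (Δ : ℝ) (f : Tor L → ℝ) : ℝ :=
  ∑ j : Fin 3, Complex.normSq (ip L (poleWave L j) (resid L Δ f)) / ((L : ℝ) ^ 2) ^ 2

open Classical in
/-- the 45-point low set as a `Finset`. -/
noncomputable def lowSet : Finset (Tor L × Tor L) := Finset.univ.filter (fun k => IsLowShell L k.1 k.2)

/-- `lowN := Σ_{k ∈ low} |R̂′(k)|² / V²`. -/
noncomputable def lowNormPart (Δ : ℝ) (f : Tor L → ℝ) : ℝ :=
  ∑ k ∈ lowSet L, Complex.normSq (cfgDFT L (resid L Δ f) k.1 k.2) / ((L : ℝ) ^ 2) ^ 2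

/-- `lowG := Σ_{k ∈ low} |R̂′(k)|² / (V² den(k))`. -/
noncomputable def lowGForm (Δ : ℝ) (f : Tor L → ℝ) : ℝ :=
  ∑ k ∈ lowSet L, Complex.normSq (cfgDFT L (resid L Δ f) k.1 k.2) / (((L : ℝ) ^ 2) ^ 2 * den L (Tplus L Δ f) k.1 k.2)

/-! ## The three β-free cruxes, the two structural lemmas, the parametrised assembly -/

/-- (KT-1″) `N₁ ≥ c · 3V²T⁺` at the ground profile (memo 21 §298: Level-1 bound `c(L,Δ) ≥ .30`, `≥ .45` for `Δ ≥ .5`). -/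
def TrialGapAbs (Δ c : ℝ) : Prop :=
  ∀ lam2 : ℝ, ∀ f : Tor L → ℝ, IsGroundTwoMagnon L Δ lam2 f → c * Uunit L Δ f ≤ trialGapN1 L Δ f

/-- (KT-2a″) `lowG ≤ a · η_eff · 3V²T⁺` (exact one-loop number; measured `≤ .038`, target `a = .06`). -/
def LowShellGFormAbs (Δ a : ℝ) : Prop :=
  ∀ lam2 : ℝ, ∀ f : Tor L → ℝ, IsGroundTwoMagnon L Δ lam2 f → lowGForm L Δ f ≤ a * etaEff L lam2 * Uunit L Δ f

/-- (KT-2b″) `‖R′‖² − P − lowN ≤ b · η_eff · (2ε₁ − T⁺) · 3V²T⁺` (measured `≤ .12`; Cauchy–Schwarz over the exact pair split gives `≤ .46`; target `b = .55`). -/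
def OffPoleTailAbs (Δ b : ℝ) : Prop :=
  ∀ lam2 : ℝ, ∀ f : Tor L → ℝ, IsGroundTwoMagnon L Δ lam2 f →
    (ip L (resid L Δ f) (resid L Δ f)).re - polePart L Δ f - lowNormPart L Δ f
      ≤ b * etaEff L lam2 * (2 * eps1 L - Tplus L Δ f) * Uunit L Δ f

/-- the non-pole, non-low denominators are `≥ ρ·(2ε₁ − T⁺)` (elementary; `ρ = 2.95` for `L ≥ 8`; minimum at the class `{(0,0),(2,1),(−1,−1)}`, `7ε₁ − E`). -/
def DenMinRest (Δ ρ : ℝ) : Prop :=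
  ∀ lam2 : ℝ, ∀ f : Tor L → ℝ, IsGroundTwoMagnon L Δ lam2 f → ∀ k₂ k₃ : Tor L,
    IsPoleK1 L k₂ k₃ = false → ¬ IsLowShell L k₂ k₃ → ρ * (2 * eps1 L - Tplus L Δ f) ≤ den L (Tplus L Δ f) k₂ k₃

/-- L2 in `Qtilde` language (LEMMA κ₀, memo 19 §250 / THEOREMS M82, at the single point `T⁺`):
`Re⟨y, Q̃(T⁺) y⟩ ≥ ĝ₀ · Σ_S |y|²/(ΔW)` for every shell vector `y`. -/
def L2Quant (Δ : ℝ) : Prop :=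
  ∀ lam2 : ℝ, ∀ f : Tor L → ℝ, IsGroundTwoMagnon L Δ lam2 f → ∀ y : Ssub L → ℂ,
    g0hat L Δ f * (∑ s : Ssub L, ‖y s‖ ^ 2 / (Δ * (Wcount L s.1 : ℝ)))
      ≤ (star y ⬝ᵥ (Qtilde L (Tplus L Δ f) Δ).mulVec y).re

/-- THE PARAMETRISED ASSEMBLY (memo 21 §301 = (KT-EXACT) + L2 + κ_E + split + pole identity + `gm3Fibre_of_checks` at `T* = T⁺`):
the arithmetic side condition `fac·η_eff·(a + b/ρ) < c` and the regime facts `T⁺ < 2ε₁`, `0 < m` are explicit hypotheses. -/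
def KTAssemblyAbs (Δ c a b ρ : ℝ) : Prop :=
  8 ≤ L → 0 < Δ → Δ < 1 → 0 < ρ →
    (∃ lam2 : ℝ, ∃ f : Tor L → ℝ, IsGroundTwoMagnon L Δ lam2 f ∧ Tplus L Δ f < 2 * eps1 L ∧ 0 < mHole L Δ f ∧
        facMI L Δ f * etaEff L lam2 * (a + b / ρ) < c) →
    TrialGapAbs L Δ c → LowShellGFormAbs L Δ a → OffPoleTailAbs L Δ b → DenMinRest L Δ ρ → L2Quant L Δ →
      GM3Fibre L Δ

/-! ## The one-loop identity layer (memo 21 §297; each verified to ≤ 1e-10 at L = 8, 12) -/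

/-- GREEN-ZERO IDENTITY: `(1/V) Σ_{k≠0} 1/(2ε(k) − λ₂) = 1/(Vλ₂) − Δ/(4(1−Δ) + Δλ₂)` for the two-magnon eigenvalue
(`f(0) = 0` by Fourier inversion + `TwoMagnonFourier` + the sum rule `Vλ₂ = 4(1−Δ)f(x̂)`; needs `0 < λ₂`, i.e. `Δ < 1`;
makes the log-divergent sum a closed form in `λ₂`). -/
def GreenZeroIdentity (Δ lam2 : ℝ) : Prop :=
  ∀ f : Tor L → ℝ, IsTwoMagnon L Δ lam2 f → 0 < lam2 → lam2 < 2 * eps1 L →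
    (∑ k ∈ (Finset.univ : Finset (Tor L)).erase 0, 1 / (2 * epsT L k - lam2)) / (L : ℝ) ^ 2
      = 1 / ((L : ℝ) ^ 2 * lam2) - Δ / (4 * (1 - Δ) + Δ * lam2)

/-- POLE PAIRING: by the `K₁`-symmetry of `R′` each pole wave sees one third of `v = p₀ + p₁ + p₂`:
`⟨p_j, R′⟩ = ⟨v, R′⟩/3`, hence `P = |⟨v,R′⟩|²/(3V²)`. -/
def PolePairingIdentity (Δ lam2 : ℝ) : Prop :=
  ∀ f : Tor L → ℝ, IsGroundTwoMagnon L Δ lam2 f → ∀ j : Fin 3,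
    ip L (poleWave L j) (resid L Δ f) = ip L (vfun L) (resid L Δ f) / 3

/-- `⟨v, R′⟩ = −3V²β T⁺ + (1−Δ)·Σ_c |v(c)|² W(c) Π⁰(c)` (the `v`-pairing of the residual is a contact sum). -/
def VResidualPairing (Δ lam2 : ℝ) : Prop :=
  ∀ f : Tor L → ℝ, IsGroundTwoMagnon L Δ lam2 f →
    ip L (vfun L) (resid L Δ f)
      = -(ip L (vfun L) (trialK1 L f)) * (Tplus L Δ f : ℂ)
        + ((1 - Δ : ℝ) : ℂ) * ∑ c : Cfg L, (Complex.normSq (vfun L c) : ℂ) * (Wcount L c : ℂ) * prodState L f c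

/-- `Π̂⁰(q₂,q₃) = (1/V) Σ_p f̂(p) f̂(q₂ + p) f̂(q₃ − p)` (the product state is one loop in momentum space). -/
def PiHatOneLoop : Prop :=
  ∀ f : Tor L → ℝ, ∀ q₂ q₃ : Tor L,
    cfgDFT L (prodState L f) q₂ q₃ = (∑ p : Tor L, dft L f p * dft L f (q₂ + p) * dft L f (q₃ - p)) / ((L : ℂ) ^ 2)

/-- `FT[f²](q) = (1/V) Σ_p f̂(p) f̂(q − p)` (convolution; with `TwoMagnonFourier` this is the `F₂` formula of memo 21 §297(A)). -/
def FsqFourier : Prop :=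
  ∀ f : Tor L → ℝ, ∀ q : Tor L,
    dft L (fun r => f r ^ 2) q = (∑ p : Tor L, dft L f p * dft L f (q - p)) / ((L : ℂ) ^ 2)

end Summit.HubbardSuperconductivity.HubbardSuperconductivity.Theorems.AnisotropyChord.Transfer.Fibre3
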